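import Summits.BirchSwinnertonDyer.BirchSwinnertonDyer.Theses.KolyvaginRankRigidityAtTwo
import Summits.BirchSwinnertonDyer.BirchSwinnertonDyer.Theorems.Rank1ResidualJetRingClassFields
import Summits.BirchSwinnertonDyer.BirchSwinnertonDyer.Theorems.ByReductionTypeAtTwoRankOneAtTwoOffBigImageOddLocalEngineEndToEnd
import Literature.NumberTheory.EllipticCurves.Jetchev2008.CoreVertices
import Summits.BirchSwinnertonDyer.BirchSwinnertonDyer.Theorems.KolyvaginRankRigidityAtTwoRegularCoreSupplyAtTwoRegularConductors
import Summits.BirchSwinnertonDyer.BirchSwinnertonDyer.Theorems.KolyvaginRankRigidityAtTwoWalkNearCore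
import Summits.BirchSwinnertonDyer.BirchSwinnertonDyer.Theorems.KolyvaginRankRigidityAtTwoStartFrameOfParity
import Summits.BirchSwinnertonDyer.BirchSwinnertonDyer.Theorems.GenusKolyvaginAtTwoGenusPrimitiveSupplyAtTwoMonskyLemma14b
import HarnessLib

set_option linter.dupNamespace false

/-!
v5.2 (krr2-p2 g17, 2026-08-29): IDENTICAL to the pen's v5.1 except that the print stub P17 `stub_twoSelmerParityOverK` is DISCHARGED by the
tree theorem `GenusKolyArch.Monsky1996_lemma14b_twoSelmerRank_parity_holds` (gk2-p5 g19) — so S1b/S1 are kernel with NO print input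
(also exported hypothesis-free as `RegularWalk.nearCoreExistenceAtTwo_holds` (gk2-p5, …StartFrameNearCoreHolds) and
`RegularCoreSupply.regularCoreSupplyAtTwo` (krr2-p2 g17, …RegularCoreSupplyAtTwoHolds)). Sorries = EXACTLY 2 = {S0 `stub_seedNonvanishingAtTwo`
(INPUT: Kolyvagin's conjecture at 2 in frame form), S2 `stub_coreRigidityAtTwo` (THE crux, beyond print)}. Registration remains the LEAD's /
KRR tenure's (W-79). BSD / U1 / S2 NOT proved.

# LINE 17 `regular_core_rigidity` — crux U1 `KolyvaginBoundedDefectAtTwo` (stmt-BirchSwinnertonDyer-28083)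
# of route `KolyvaginRankRigidityAtTwo` (KRR), ideator seat `bsd-idea-1` (D-0145, gen 9–13; technique card
# «compactness–contradiction / RIGIDITY»; director focus: beyond-print theorems at the prime 2).

TARGET BY NAME: `Summit.BirchSwinnertonDyer.BirchSwinnertonDyer.Theses.KolyvaginRankRigidityAtTwo.KolyvaginBoundedDefectAtTwo`
(U1 = the SEED HALF of V1′∞ `KolyvaginStrongNonzeroSystemAtTwo`; U2 `FullClassDeepeningAtTwo` is landed
modulo Gross 1991 Prop. 3.7 (2), so U1 is what stands between the asided bare non-vanishing V1′ and KRR's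
deciding input V1′∞). No summit, no rung and no crux is proved by this file; BSD is not proved.

## v5 (2026-08-29 g13) — THE WALK IS KERNEL: N4 cited BY NAME; registered stubs {S0, P17, N3‴, S2}
krr2-p2 g15 landed the regular-prime walk END TO END (p695209 WalkBridge · p696690 WalkFrameAlgebra · p696851 WalkStepGood ·
p697123 WalkStepPureAlgebra · p697667 WalkStepPure · p698422 Walk · p699243 WalkRounds · **p700395 WalkNearCore**):
`KolyvaginAtTwo.RegularWalk.nearCoreExistenceAtTwo_of_startFrame : StartFrame → ⟨NearCoreExistenceAtTwo VERBATIM⟩`.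
v5 therefore DELETES the N4′ stub and cuts S1b as

  S1b `NearCoreExistenceAtTwo` ⇐ (kernel, by name) `nearCoreExistenceAtTwo_of_startFrame`
      ⇐ `StartFrameAtTwo` (walk currency: VERBATIM the hypothesis of that theorem — signs `sg`, depth data `m, i₀, J, d` BEFORE `∀ k`,
        clauses (F3)/(F4) through `res_{k+1}` = `h1Eval` on `torsionFixing 2^(k+1)`; critic #262 PRICE (1) «quantifier order» paid)
      ⇐ (kernel, THIS FILE, sorry-free) `startFrameAtTwo_of_selmerEigenframe`
      ⇐ N3‴ `SelmerEigenframeAtTwo` (Selmer currency; THE registered stub is `stub_selmerEigenframeAtTwo : P17 → SelmerEigenframeAtTwo`).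

N3‴ says: on U1's habitat and for the non-trivial `τ ∈ Gal(K/ℚ)` there are LEVEL-FREE ranks `r₊, r₋` with `r₊ + r₋` ODD and a
generation exponent `J₀` such that every `Sel_{2^k}(E/K) = H_{𝓕(1)}(K, E[2^k])` (`Jetchev2008.modifiedSelmerGroup W K ι 2^k 1`) contains
`τ`-FIXED classes `e₁ … e_{r₊}` and `τ`-ANTI-FIXED classes `f₁ … f_{r₋}`, none killed by `2^(k−1)`, JOINTLY FREE WITH LOSS ONE
(`∑ aᵢeᵢ + ∑ bⱼfⱼ = 0 ⇒ 2^(k−1) ∣ aᵢ, bⱼ`) and generating up to `2^J₀` (`2^J₀ · Sel_{2^k} ⊆ span`).  This is EXACTLY the output shape of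
the pen's sorry-free capstone `EigenframeFinite.eigenframe_of_divisible_finite` (HOME `line17/EigenframeFiniteLevel.lean` v2.1, evidence #28/#30
on 28083: for ANY additive involution `τ` and `τ`-stable 2-divisible `C` with `C[2]` finite) transported through the DICTIONARY
`T_k : H¹(K, E[2^k]) ⥲ H¹(K, E[2^∞])[2^k]` (`E(K)[2] = 0`; `T_k⁻¹ Sel_{2^∞} = Sel_{2^k}`), with `C := div Sel_{2^∞}(E/K) = 2^{κ₀} Sel_{2^∞}`,
`J₀ = κ₀ + 1`, and ODDNESS `r₊ + r₋ = corank_{ℤ₂} Sel_{2^∞}(E/K) ≡ 1 (mod 2)` = P17 (2-parity over `K`, print) ⊕ the corank formula ⊕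
Cassels–Tate evenness of `dim (Ш[2^∞]/div)[2]` — ALL THREE algebraic inputs are sorry-free pen helpers awaiting a prover's landing
(`EigenframeFiniteLevel.lean` capstone, `EigenRankIdentity.lean` `natCard_torsionBy_two_eq_mul_of_involution` r₊+r₋ = dim C[2],
`natCard_torsionBy_eq_quotient_mul`), the Cassels–Tate kernel is the TREE theorem `WeierstrassCurve.exists_casselsTate_pairing_holds` +
`even_finrank_modN_primaryComponent_sha`.  So the HONEST RESIDUE of N3‴ = the dictionary `T_k` in `galH1Torsion` currency (reader g15
§Addendum B step 1; `torsionToPrimaryH1` exists at level `p` only) + P17.  Size M⁻, ONE hand (critic #262 price (2)).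
The kernel bridge `startFrameAtTwo_of_selmerEigenframe` (this file, no sorry): `g := Fin.append e f`, `sg := (+1,…,+1,−1,…,−1)` (level-free
because `r₊, r₋` are), `i₀ := 0` (every member has exact order `2^k`: killed by `2^k` = `zsmul_galH1Torsion_eq_zero`, not by `2^(k−1)`),
(F3) with `J = J₀` (the difference is `0`), (F4) with `d = 2` (Sah at `2`, `RegularWalk.two_zsmul_eq_zero_of_res_eq_zero`: `res_{k+1}(∑bᵢgᵢ) = 0
⇒ 2∑bᵢgᵢ = 0 ⇒ 2^(k−1) ∣ 2bᵢ ⇒ 2^(k−2) ∣ bᵢ`).  The walk-currency road stays open too: `nearCoreExistenceAtTwo_of_startFrame'` consumes a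
direct landing of `TwoSelmerParityOverK → StartFrameAtTwo` (reader g15's `stub_startFrameAtTwo` text, evidence `regular_core_rigidity_v5_draft.lean`).
REGISTERED STUBS v5 = {S0 `stub_seedNonvanishingAtTwo` (INPUT, by name), P17 `stub_twoSelmerParityOverK` (PRINT, by name in content),
N3‴ `stub_selmerEigenframeAtTwo` (M⁻, the ONE hand), S2 `stub_coreRigidityAtTwo` (XL, hardest, beyond print)} — sorry count 4, zero elsewhere;
`KolyvaginBoundedDefectAtTwo_of_stubs ⊢ KolyvaginBoundedDefectAtTwo` BY NAME.  HONEST RESIDUAL of LINE 17 after v5 = {S0 seed (input, never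
progress), S2 core rigidity at 2 (hardest; K1 finite-group row decides), N3‴ dictionary + P17 (print, never progress)}; (N4) walk and (N5)
value engine are KERNEL.  Registration = the 28083 LEAD / KRR tenure (interim single-slot rule; W-79): `ledger crux write
stmt-BirchSwinnertonDyer-28083 Lines/regular_core_rigidity.lean --file <this>` then `ledger skeleton check … --crux stmt-BirchSwinnertonDyer-28083`.
BSD is NOT proved; U1, S1b (unconditionally), N3‴, S2 are NOT proved; P17 is print, unproved in tree.

HISTORY (one line each; files kept in HOME `line17/`): v3 (g10, OF RECORD, sha b4a2711060ce) stubs {S0, S1b, S2} · v3.2 (g11) S1b′ behind P17 ·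
v4/v4.1 (g12, critic #230) S1b′ ⇐ N3′ + N4, N5 by name · v4.2 (g12, critic #262 PASS as map) N3″ eigenframe export + N4′ · v5 (g13) N4 KERNEL.

IDEA (Mazur–Rubin CORE RIGIDITY transplanted to `p = 2` through REGULAR Kolyvagin primes; unchanged since v1). Mazur–Rubin
(PCMS 18 (2011) §2.4/§3.1, hypotheses (H.2)–(H.4); Cor. 2.8.9 (2), Thm. 3.2.3) and Howard (Compos. 140
(2004) Thm. 1, "assume p odd") prove: when the core rank is one, the module of Kolyvagin systems is FREE OF
RANK ONE, every generator is primitive, and at a CORE VERTEX `n` (modified Selmer group `H_{𝓕(n)}(K, E[p^M])`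
free of rank one over `ℤ/p^M`) restriction `KS → H_{𝓕(n)}` is an isomorphism. Consequence ("rigidity"): a
non-zero Kolyvagin system `κ = p^a · κ^prim` has `ord κ_n = p^{M−a}` at EVERY core vertex of EVERY level
`M > a` — the defect `a` is ONE global integer. That is exactly U1's shape (`m := a`), and it turns the
bare seed V1′ (one non-zero class somewhere) into bounded defect at all levels.  At `p = 2`, (H.2) "`A/(τ−1)A` free of
rank one" fails at Kolyvagin's primes (Frobenius = complex conjugation `c₀ = diag(1,−1)`: `E[2^M]/(c₀−1) ≅ ℤ/2^M ⊕ ℤ/2`) but HOLDS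
VERBATIM at a REGULAR prime `ℓ` (arithmetic Frobenius `h` an involution on `E[2^M]` with `2^{M−1}(1+h)E[2^M] ≠ 0`, i.e.
`h ~ [[0,1],[1,0]]`): `E[2^M]/(h−1) ≅ (1+h)E[2^M] ≅ ℤ/2^M`, and `φ_ℓ^{fs}` is a lossless isomorphism of free rank-one
`ℤ/2^M`-modules.  Regular Kolyvagin primes of every level with prescribed local behaviour EXIST on this habitat (in-tree engine
`OffBigImageOddLocalAtTwo.Engine.exists_regular_kolyvaginPrime_of_heegner`, stmt-23716 cell).  The residual 2-specific obstruction
(H.3) — the phantom `H¹(ℚ(E[2^M])/ℚ, E[2^M]) ≅ ℤ/2` (Lawson–Wuthrich 2016) — is INVISIBLE at regular primes (`H¹(⟨h⟩, E[2^M]) = 0`,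
toy-checked below by `decide`), hence never cut away: the core notion at 2 is SIGN-FREE with a UNIFORM ERROR `κ` (near-core), and S2's
defect `a = a(κ)` absorbs it.
-/

noncomputable section

/-! ## v5.1 (pen bsd-idea-1 g13, 2026-08-29T07:37Z) — N3‴ DISCHARGED BY NAME: the START FRAME IS A TREE THEOREM MODULO PRINT
krr2-p2 g16 landed `RegularWalk.startFrameAtTwo_of_twoSelmerParity (h14 : Monsky1996_lemma14b_twoSelmerRank_parity) : ⟨StartFrameAtTwo verbatim⟩`
(`Theorems/KolyvaginRankRigidityAtTwoStartFrameOfParity.lean`, p704817; with `…StartFrameEigenRank` p703786, `…StartFrameEigenframe` p704056 —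
the pen's eigenframe algebra landed as `KolyvaginAtTwo.EigenframeFinite`), so S1b = `nearCoreExistenceAtTwo_of_startFrame ∘ startFrameAtTwo_of_twoSelmerParity`
is KERNEL modulo the PRINT fact `h14`.  CHANGES v5 → v5.1: (i) the N3‴ stub `stub_selmerEigenframeAtTwo` is REMOVED (tombstone below; its content is
krr2-p2's theorem — nothing to re-file); (ii) P17 is now the Literature constant BY NAME: `stub_twoSelmerParityOverK : Monsky1996_lemma14b_twoSelmerRank_parity`
(PRINT = Monsky 1996 L.1.4(b) / Kramer 1981 Thm. 1; a cite item, never progress; closes by `exact h14` the day the fact is a hypothesis of the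
route or proved); (iii) S1b road = `nearCoreExistenceAtTwo_of_parity` (kernel ∘ krr2-p2's theorem, BY NAME); the v5 eigenframe road
(`SelmerEigenframeAtTwo`, bridge `startFrameAtTwo_of_selmerEigenframe`, `nearCoreExistenceAtTwo_of_eigenframe`) stays in the file sorry-free as the
alternative road, consuming a hypothesis only.  REGISTERED-SHAPE STUBS v5.1 = {S0 `stub_seedNonvanishingAtTwo` (INPUT), P17 `stub_twoSelmerParityOverK`
(PRINT, by name), S2 `stub_coreRigidityAtTwo` (XL, THE crux of the line, beyond print)} — sorry count 3, zero elsewhere; `KolyvaginBoundedDefectAtTwo_of_stubs`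
⊢ U1 BY NAME.  HONEST RESIDUAL of LINE 17 after v5.1 = S2 alone (plus the S0 input and the P17 print fact).  NOT registered by the pen (W-79):
LEAD / KRR tenure: `ledger crux write stmt-BirchSwinnertonDyer-28083 Lines/regular_core_rigidity.lean --file <this>` then
`ledger skeleton check $(ledger crux dir stmt-BirchSwinnertonDyer-28083)/Lines/regular_core_rigidity.lean --crux stmt-BirchSwinnertonDyer-28083`.
BSD is NOT proved; U1 is NOT proved (S0, S2 open; P17 print). -/

namespace Summit.BirchSwinnertonDyer.BirchSwinnertonDyer.Cruxes.KolyvaginBoundedDefectAtTwo.RegularCoreRigidity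

open scoped Classical Pointwise
open WeierstrassCurve NumberField IsDedekindDomain Field
open Literature.NumberTheory.GaloisRepresentations Literature.NumberTheory.EllipticCurves
open Literature.NumberTheory
open Rat.HeightOneSpectrum
open Summit.BirchSwinnertonDyer.BirchSwinnertonDyer.Theses.KolyvaginRankRigidityAtTwo

universe u

/-- TOY CHECK of the lever (in-Lean, `decide`): for the regular involution `h = [[0,1],[1,0]]` on `(ℤ/4)²`,
`ker(1 + h) = im(h − 1)`, i.e. `H¹(⟨h⟩, E[4]) = 0` — every cocycle (in particular the (H.3) phantom) restricts to
ZERO on a regular Frobenius; contrast `c₀ = diag(1,−1)`, where `(2,0) ∈ ker(1 + c₀) ∖ im(c₀ − 1)`. [folklore] -/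
theorem regularInvolution_h1_trivial_mod4 :
    ∀ a b : ZMod 4, a + b = 0 → ∃ c d : ZMod 4, d - c = a ∧ c - d = b := by
  decide

/-- The same at level `8`. [folklore] -/
theorem regularInvolution_h1_trivial_mod8 :
    ∀ a b : ZMod 8, a + b = 0 → ∃ c d : ZMod 8, d - c = a ∧ c - d = b := by
  decide

/-- … whereas for the DIAGONAL complex conjugation `c₀ = diag(1,−1)` on `(ℤ/4)²`: `(2,0) ∈ ker(1 + c₀)`
(`2 + 2 = 0`, `0 − 0 = 0`) but `(2,0) ∉ im(c₀ − 1) = {(c − c, −d − d)}` — a non-trivial class in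
`H¹(⟨c₀⟩, E[4])`: diagonal Kolyvagin primes DO see the phantom, regular ones never. [folklore] -/
theorem diagonalInvolution_h1_nontrivial_mod4 :
    ((2 : ZMod 4) + 2 = 0 ∧ (0 : ZMod 4) - 0 = 0) ∧ ¬ ∃ c d : ZMod 4, c - c = 2 ∧ -d - d = 0 := by
  decide


/-- S1 · REGULAR CORE SUPPLY AT 2 (on U1's habitat and frame, verbatim binders + the ring-class-field
instance binder, discharged by `JET.numberField_ringClassField`): there is a depth `r` such that for every
level `M ≥ 1` and bound `b` some conductor `n` with exactly `r` prime factors, all of them regular Kolyvagin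
primes `> b` of Kolyvagin index `≥ M` (so `M ≤ M(n)`), carries a Kolyvagin–Heegner datum of the frame and
is a sign-free NEAR-core vertex at level `2^M` with a UNIFORM error exponent `κ` (room for the regular-invisible phantom). Mazur–Rubin Cor. 2.7.3 ("there are core vertices n with
ω(n) = r", r = dim of the residual Selmer group off the core line) at p = 2, the Čebotarev choices made
REGULAR by the in-tree engine `exists_regular_kolyvaginPrime_of_heegner` (exact local orders prescribed
for finitely many classes ⇒ each added regular prime cuts the non-core part by a free rank-one quotient).
Why it might fail: the engine prescribes local ORDERS of classes, MR's core-vertex induction needs the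
localisation to be SURJECTIVE onto `H¹_f(K_λ, E[2^M]) ≅ E[2^M]/(h−1) ≅ ℤ/2^M` for a chosen class and zero
for the others — at 2 the phantom class in `H¹(K(E[2^M])/K, E[2^M]) ≅ ℤ/2` (Lawson–Wuthrich) may block
exactly one bit, leaving index-2 "near-cores" only. -/
def RegularCoreSupplyAtTwo : Prop :=
  ∀ (W : WeierstrassCurve ℚ) [W.IsElliptic] [W.IsGloballyMinimal], ¬ W.HasCM → (Literature.NumberTheory.EllipticCurves.Rank1Residual.GoodOrd W 2 ∨ Literature.NumberTheory.EllipticCurves.Rank1Residual.Mult W 2) → (∀ m : ℕ, W.HasSurjectiveModNGaloisRep (2 ^ m : ℕ)) → ∀ (K : Type) [Field K] [NumberField K], Literature.NumberTheory.EllipticCurves.IsImaginaryQuadratic K → ∀ [NeZero (W.conductorNorm ℤ)], Literature.NumberTheory.EllipticCurves.SatisfiesHeegnerHypothesis (W.conductorNorm ℤ) K → Odd (NumberField.discr K) → NumberField.discr K ≠ -3 → AddSubgroup.torsionBy (W.baseChange K).toAffine.Point (2 : ℤ) = ⊥ → Literature.NumberTheory.EllipticCurves.SatisfiesHeegnerHypothesis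 2 K → ∀ (Dt : Literature.NumberTheory.EllipticCurves.ModularForms.ModularParametrizationData W (W.conductorNorm ℤ)) (β : ℤ) (ι : K →+* ℂ) [∀ k : ℕ, NumberField (ringClassField K ι k)], (4 * (W.conductorNorm ℤ : ℤ)) ∣ β ^ 2 - NumberField.discr K →
    ∃ r κ : ℕ, ∀ (M b : ℕ), 1 ≤ M →
      ∃ n : ℕ, Nonempty (Literature.NumberTheory.EllipticCurves.KolyvaginHeegnerData Dt β ι n) ∧
        Literature.NumberTheory.EllipticCurves.KolyvaginDescent.KolSupp (Literature.NumberTheory.EllipticCurves.Zhang2014.IsKolyvaginPrime (W.conductorNorm ℤ) W K 2) n ∧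
        n.primeFactors.card = r ∧
        (∀ ℓ ∈ n.primeFactors, b < ℓ ∧ M ≤ Literature.NumberTheory.EllipticCurves.Zhang2014.kolyvaginIndex W 2 ℓ ∧ (∃ (v : HeightOneSpectrum (𝓞 ℚ)) (𝔓 : Ideal (absIntegers (𝓞 ℚ) ℚ)) (h : absoluteGaloisGroup ℚ), (ℓ : 𝓞 ℚ) ∈ v.asIdeal ∧ 𝔓 ∈ v.primesAbove ∧ IsArithFrobAt (𝓞 ℚ) h 𝔓 ∧ (∀ X : geomTorsion W ((2 ^ M : ℕ) : ℤ), h • h • X = X) ∧ ∃ P : geomTorsion W ((2 ^ M : ℕ) : ℤ), (2 : ℤ) ^ (M - 1) • (P + h • P) ≠ 0)) ∧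
        (∃ x ∈ Jetchev2008.modifiedSelmerGroup W K ι ((2 ^ M : ℕ) : ℤ) n, addOrderOf x = 2 ^ M ∧ ∀ y ∈ Jetchev2008.modifiedSelmerGroup W K ι ((2 ^ M : ℕ) : ℤ) n, ∃ t : ℤ, (2 ^ κ : ℤ) • y = t • x)

/-- S1b · SIGN-FREE NEAR-CORE EXISTENCE AT 2 — the load-bearing half of S1, ISOLATED (v3) after the ONE READER's report
(`Cruxes/KolyvaginBoundedDefectAtTwo/S1-READER-g12.md`, seat krr2-p2 g12, 2026-08-28T21:18Z; its recommendation (3)): on U1's habitat and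
frame there are a depth `r` and an error exponent `κ` such that for every level `M ≥ 1` and bound `b` some SQUARE-FREE conductor `n` with
exactly `r` prime factors — all Zhang–Kolyvagin primes at `2`, `> b`, of Kolyvagin index `≥ M` and REGULAR at level `2^M` (the
regularity predicate spelled out: an arithmetic Frobenius `h` over `ℓ` with `h² = 1` on `E[2^M]` and `2^(M−1)(P + hP) ≠ 0` for some `P`)
— is a sign-free near-core vertex of error `κ` (spelled out: a class `x` of exact order `2^M` in the tree's parameter-free
`Jetchev2008.modifiedSelmerGroup W K ι 2^M n` with `2^κ · H ⊆ ℤx`).  The SUPPLY half of S1 (regular Kolyvagin conductors of every depth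
carrying a Kolyvagin–Heegner datum) is the tree theorem `KolyvaginAtTwo.RegularCoreSupply.exists_regularKolyvaginConductor`, and
S1 ⇐ S1b is `KolyvaginAtTwo.RegularCoreSupply.regularCoreSupply_of_nearCoreSupply` (both krr2-p2 g12, p668568, sorry-free) — used
below, so S1 is no longer a stub.  Predicates are INLINED (no local `def`) so that a `Theorems/` proof can state this stub byte-identically
without importing a sorried file.  Why it might fail (the reader's finding (2)(b)–(c)): at a regular `λ` the local condition
`H¹_f(K_λ, E[2^M]) = E[2^M]` is free of rank ONE over `ℤ/2^M[Gal(K/ℚ)]` but of rank TWO over `ℤ/2^M`; `±`-classes cut the modified Selmer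
group by index at most `2^(2M−1)` per prime and a pure-sign Selmer group only by `2^M`, leaving a transverse REFILL `ℤ/2^a`, `a ∈ [1, M]`,
NOT determined by local duality + the Poonen–Rains form — so near-core existence needs a 2-adic REFILL LAW at regular primes
(`a ≥ M − O(1)`), the same missing lemma S2 needs; MR04 Cor. 2.7.3 / Jetchev L.5.2(iii) / Howard are `p` odd.  Deciding instrument (reader):
REG-REFILL at `M = 2` (refill exponent of `H_{𝓕(ℓ)}(K, E[4])` on pure-sign rank-3 frames at regular Kolyvagin `ℓ` of index `≥ 2`;
Magma-class row, not run).  [cite: MazurRubin2004, Cor. 2.7.3, Def. 2.5.3] [cite: Howard2004, Thm. 2.6.1] [cite: Jetchev2008, §5.2] -/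
def NearCoreExistenceAtTwo : Prop :=
  ∀ (W : WeierstrassCurve ℚ) [W.IsElliptic] [W.IsGloballyMinimal], ¬ W.HasCM → (Literature.NumberTheory.EllipticCurves.Rank1Residual.GoodOrd W 2 ∨ Literature.NumberTheory.EllipticCurves.Rank1Residual.Mult W 2) → (∀ m : ℕ, W.HasSurjectiveModNGaloisRep (2 ^ m : ℕ)) → ∀ (K : Type) [Field K] [NumberField K], Literature.NumberTheory.EllipticCurves.IsImaginaryQuadratic K → ∀ [NeZero (W.conductorNorm ℤ)], Literature.NumberTheory.EllipticCurves.SatisfiesHeegnerHypothesis (W.conductorNorm ℤ) K → Odd (NumberField.discr K) → NumberField.discr K ≠ -3 → AddSubgroup.torsionBy (W.baseChange K).toAffine.Point (2 : ℤ) = ⊥ → Literature.NumberTheory.EllipticCurves.SatisfiesHeegnerHypothesis 2 K → ∀ (Dt : Literature.NumberTheory.EllipticCurves.ModularForms.ModularParametrizationData W (W.conductorNorm ℤ)) (β : ℤ) (ι : K →+* ℂ) [∀ k : ℕ, NumberField (ringClassField K ι k)], (4 * (W.conductorNorm ℤ : ℤ)) ∣ β ^ 2 - NumberField.discr K →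
    ∃ r κ : ℕ, ∀ (M b : ℕ), 1 ≤ M →
      ∃ n : ℕ, Squarefree n ∧ n.primeFactors.card = r ∧
        (∀ ℓ ∈ n.primeFactors, Literature.NumberTheory.EllipticCurves.Zhang2014.IsKolyvaginPrime (W.conductorNorm ℤ) W K 2 ℓ ∧ b < ℓ ∧
          M ≤ Literature.NumberTheory.EllipticCurves.Zhang2014.kolyvaginIndex W 2 ℓ ∧ (∃ (v : HeightOneSpectrum (𝓞 ℚ)) (𝔓 : Ideal (absIntegers (𝓞 ℚ) ℚ)) (h : absoluteGaloisGroup ℚ), (ℓ : 𝓞 ℚ) ∈ v.asIdeal ∧ 𝔓 ∈ v.primesAbove ∧ IsArithFrobAt (𝓞 ℚ) h 𝔓 ∧ (∀ X : geomTorsion W ((2 ^ M : ℕ) : ℤ), h • h • X = X) ∧ ∃ P : geomTorsion W ((2 ^ M : ℕ) : ℤ), (2 : ℤ) ^ (M - 1) • (P + h • P) ≠ 0)) ∧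
        (∃ x ∈ Jetchev2008.modifiedSelmerGroup W K ι ((2 ^ M : ℕ) : ℤ) n, addOrderOf x = 2 ^ M ∧ ∀ y ∈ Jetchev2008.modifiedSelmerGroup W K ι ((2 ^ M : ℕ) : ℤ) n, ∃ t : ℤ, (2 ^ κ : ℤ) • y = t • x)

/-- **S1 ⇐ S1b** (v3; bookkeeping by krr2-p2's landed generic reduction with `Reg` := regularity and `Core` := near-core, inlined;
the Kolyvagin–Heegner datum from Gross §3 CM, proved in tree).  No sorry. -/
theorem regularCoreSupplyAtTwo_of_nearCore (h : NearCoreExistenceAtTwo) : RegularCoreSupplyAtTwo := by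
  intro W _ _ hCM hred hsurj K _ _ hK _ hH hodd hd3 htors hH2 Dt β ι _ hβ
  exact Summit.BirchSwinnertonDyer.BirchSwinnertonDyer.Theorems.KolyvaginAtTwo.RegularCoreSupply.regularCoreSupply_of_nearCoreSupply
    hK hH Dt β ι hβ (h W hCM hred hsurj K hK hH hodd hd3 htors hH2 Dt β ι hβ)

/-- S2 · CORE RIGIDITY AT 2 (THE HARDEST STUB; beyond print). On U1's habitat and frame: a SEED — one
non-zero Kolyvagin class `c_{M₁}(n₁) ≠ 0` at some Kolyvagin conductor and level `1 ≤ M₁ ≤ M(n₁)` (the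
conclusion of `KolyvaginNonvanishingAtTwoFrame`, verbatim) — forces, for each error exponent `κ`, ONE global defect `a : ℕ` such that at
EVERY sign-free near-core vertex (error `κ`) `(n, M)` supported on regular Kolyvagin primes of index `≥ M`, and every level
`M > a`, every Kolyvagin–Heegner datum `d` of conductor `n` has `2^(M−a−1) · c_M(n) ≠ 0` (order ≥ 2^{M−a}).
Mazur–Rubin Cor. 2.8.9 (2) / Thm. 3.2.3 (KS free of rank one over ℤ₂, generated by a primitive `κ^prim`,
`κ^Heeg = 2^a κ^prim`, `a < ∞` iff `κ^Heeg ≠ 0` ⟸ seed) + Thm. 2.8.5 / Howard Thm. 2.8.8 (at a core vertex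
`KS → H_{𝓕(n)} ≅ ℤ/2^M` is an isomorphism, so `κ^prim_n` generates and `ord κ^Heeg_n = 2^{M−a}`), run at
p = 2 with (H.2) := REGULARITY of the primes (`E[2^M]/(h−1) ≅ ℤ/2^M`) and (H.4) replaced by the engine's
simultaneous Frobenius prescription. Why it might fail: (H.3) fails at 2 — the phantom
`H¹(ℚ(E[2^M])/ℚ, E[2^M]) ≅ ℤ/2` (Lawson–Wuthrich 2016) may make `KS(E[2^M])` free of rank one only up to
a 2-torsion error that is NOT uniform in `M`, or Howard's surjectivity `Γ(H₀) ↠ H₀(n)` may lose one bit per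
prime (then `a` would grow with the depth `r` — still fine for U1 at fixed `r` — or with `M` — fatal).
Honours the Disproof-side facts on the sibling cruxes: it USES the seed (no seed ⇒ no bound: `a = ∞`), and it
restricts to CORE vertices (at non-core `n` the class order is eaten by `M_n`, defect unbounded — the
recorded reason "uniform defect over all n" is false). -/
def CoreRigidityAtTwo : Prop :=
  ∀ (W : WeierstrassCurve ℚ) [W.IsElliptic] [W.IsGloballyMinimal], ¬ W.HasCM → (Literature.NumberTheory.EllipticCurves.Rank1Residual.GoodOrd W 2 ∨ Literature.NumberTheory.EllipticCurves.Rank1Residual.Mult W 2) → (∀ m : ℕ, W.HasSurjectiveModNGaloisRep (2 ^ m : ℕ)) → ∀ (K : Type) [Field K] [NumberField K], Literature.NumberTheory.EllipticCurves.IsImaginaryQuadratic K → ∀ [NeZero (W.conductorNorm ℤ)], Literature.NumberTheory.EllipticCurves.SatisfiesHeegnerHypothesis (W.conductorNorm ℤ) K → Odd (NumberField.discr K) → NumberField.discr K ≠ -3 → AddSubgroup.torsionBy (W.baseChange K).toAffine.Point (2 : ℤ) = ⊥ → Literature.NumberTheory.EllipticCurves.SatisfiesHeegnerHypothesis 2 K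 → ∀ (Dt : Literature.NumberTheory.EllipticCurves.ModularForms.ModularParametrizationData W (W.conductorNorm ℤ)) (β : ℤ) (ι : K →+* ℂ) [∀ k : ℕ, NumberField (ringClassField K ι k)], (4 * (W.conductorNorm ℤ : ℤ)) ∣ β ^ 2 - NumberField.discr K → ∀ κ : ℕ,
    (∃ (n₁ : ℕ) (d₁ : Literature.NumberTheory.EllipticCurves.KolyvaginHeegnerData Dt β ι n₁) (M₁ : ℕ),
        Literature.NumberTheory.EllipticCurves.KolyvaginDescent.KolSupp (Literature.NumberTheory.EllipticCurves.Zhang2014.IsKolyvaginPrime (W.conductorNorm ℤ) W K 2) n₁ ∧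
        1 ≤ M₁ ∧ (M₁ : ℕ∞) ≤ Literature.NumberTheory.EllipticCurves.Zhang2014.levelIndex W 2 n₁ ∧ d₁.kolyvaginClass Nat.prime_two M₁ ≠ 0) →
    ∃ a : ℕ, ∀ (M n : ℕ) (d : Literature.NumberTheory.EllipticCurves.KolyvaginHeegnerData Dt β ι n),
      Literature.NumberTheory.EllipticCurves.KolyvaginDescent.KolSupp (Literature.NumberTheory.EllipticCurves.Zhang2014.IsKolyvaginPrime (W.conductorNorm ℤ) W K 2) n →
      (∀ ℓ ∈ n.primeFactors, M ≤ Literature.NumberTheory.EllipticCurves.Zhang2014.kolyvaginIndex W 2 ℓ ∧ (∃ (v : HeightOneSpectrum (𝓞 ℚ)) (𝔓 : Ideal (absIntegers (𝓞 ℚ) ℚ)) (h : absoluteGaloisGroup ℚ), (ℓ : 𝓞 ℚ) ∈ v.asIdeal ∧ 𝔓 ∈ v.primesAbove ∧ IsArithFrobAt (𝓞 ℚ) h 𝔓 ∧ (∀ X : geomTorsion W ((2 ^ M : ℕ) : ℤ), h • h • X = X) ∧ ∃ P : geomTorsion W ((2 ^ M : ℕ) : ℤ), (2 : ℤ) ^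 (M - 1) • (P + h • P) ≠ 0)) →
      (∃ x ∈ Jetchev2008.modifiedSelmerGroup W K ι ((2 ^ M : ℕ) : ℤ) n, addOrderOf x = 2 ^ M ∧ ∀ y ∈ Jetchev2008.modifiedSelmerGroup W K ι ((2 ^ M : ℕ) : ℤ) n, ∃ t : ℤ, (2 ^ κ : ℤ) • y = t • x) → a < M →
      (2 ^ (M - a - 1) : ℤ) • d.kolyvaginClass Nat.prime_two M ≠ 0

/-- S0 (BY NAME): the seed — Kolyvagin's conjecture at 2 in frame form, V1′ of the route
(`KolyvaginNonvanishingAtTwoFrame`; equivalent to the asided item V1′ `KolyvaginNonvanishingAtTwo` by the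
turnkey's `nonvanishingFrame_of`). Beyond print (W. Zhang 2014 / BCGS need p odd); it is the INPUT of the line. -/
theorem stub_seedNonvanishingAtTwo : KolyvaginNonvanishingAtTwoFrame := by
  sorry

/-- P17 · 2-PARITY OVER QUADRATIC FIELDS, Kramer–Monsky form (v3.2; a PRINT input, BY NAME in content): VERBATIM the body of the tree's
named fact `Literature.NumberTheory.EllipticCurves.Monsky1996_lemma14b_twoSelmerRank_parity` (Monsky 1996 Lemma 1.4(b) for `F = ℚ`
= Kramer 1981 Thm. 1 with Prop. 3 and the product formula): for elliptic `W/ℚ` and quadratic `K` in which `2` and every `p ∣ N_W` split,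
`rank W(K) + dim_{𝔽₂} Ш(W/K)[2] ≡ r₂(K) (mod 2)`.  INLINED rather than imported because the farm snapshot does not build the leaf module
`Literature.NumberTheory.EllipticCurves.TwoSelmerRankQuadraticParity` (nobody imports it; `lean check` rc 75 `remote:stale:unbuilt` ×3,
2026-08-29T00:40–00:55Z); once it builds, `example : TwoSelmerParityOverK ↔ Monsky1996_lemma14b_twoSelmerRank_parity := Iff.rfl`, and the by-name stub
below closes by `exact Monsky1996_lemma14b_twoSelmerRank_parity_holds` the day that fact is typed.  NOT proved in tree; never progress.
[cite: Monsky1996, Lemma 1.4(b) (p. 417)] [cite: Kramer1981, Thm. 1, Prop. 3] -/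
def TwoSelmerParityOverK : Prop :=
  ∀ (W : WeierstrassCurve ℚ) [W.IsElliptic] (K : Type) [Field K] [NumberField K],
    Module.finrank ℚ K = 2 → Literature.NumberTheory.EllipticCurves.SatisfiesHeegnerHypothesis 2 K →
      Literature.NumberTheory.EllipticCurves.SatisfiesHeegnerHypothesis (W.conductorNorm ℤ) K →
        ∀ u : ℕ, Nat.card (AddSubgroup.torsionBy (W.baseChange K).sha (2 : ℤ)) = 2 ^ u →
          ((W.baseChange K).mordellWeilRank + u) % 2 = NumberField.InfinitePlace.nrComplexPlaces K % 2

/-- **N3 (walk currency) · START FRAME AT 2** — VERBATIM the hypothesis of the landed kernel theorem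
`KolyvaginAtTwo.RegularWalk.nearCoreExistenceAtTwo_of_startFrame` (krr2-p2 g15, p700395; conclusion = S1b verbatim): on U1's habitat and
frame and for the non-trivial `τ ∈ Gal(K/ℚ)` there are `m, sg : Fin m → {±1}, i₀, J, d` with `m` ODD — ALL BEFORE `∀ k` (the walk's prime count
`max P N` is level-free because the sign census is) — such that every `Sel_{2^k}(E/K) = H_{𝓕(1)}` carries a `τ`-eigenframe `g` of pattern `sg`
with `ord g_{i₀} = 2^k`, (F3) `2^J · Sel_{2^k} ⊆ ⟨g⟩ + ker res_{k+1}` and (F4) `res_{k+1}(∑ bᵢgᵢ) = 0 ⇒ 2^(k−d) ∣ bᵢ`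
(`res_{k+1}` = restriction to `Γ_{K(E[2^(k+1)])}`, spelled with `h1Eval`/`torsionFixing`).  Derived below from N3‴ by the sorry-free bridge
`startFrameAtTwo_of_selmerEigenframe` (`J = J₀`, `d = 2`, `i₀ = 0`); a DIRECT landing of `TwoSelmerParityOverK → StartFrameAtTwo` (reader g15's
`stub_startFrameAtTwo`, S1-READER-g15 §Addendum A/B) is consumed by `nearCoreExistenceAtTwo_of_startFrame'` just as well.
[cite: MazurRubin2004, Cor. 2.7.3] [cite: Jetchev2008, Prop. 5.3] [cite: GrossLMS1991, §9 Prop. 9.1] -/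
def StartFrameAtTwo : Prop :=
  ∀ (W : WeierstrassCurve ℚ) [W.IsElliptic] [W.IsGloballyMinimal], ¬ W.HasCM → (Literature.NumberTheory.EllipticCurves.Rank1Residual.GoodOrd W 2 ∨ Literature.NumberTheory.EllipticCurves.Rank1Residual.Mult W 2) → (∀ m : ℕ, W.HasSurjectiveModNGaloisRep (2 ^ m : ℕ)) → ∀ (K : Type) [Field K] [NumberField K], Literature.NumberTheory.EllipticCurves.IsImaginaryQuadratic K → ∀ [NeZero (W.conductorNorm ℤ)], Literature.NumberTheory.EllipticCurves.SatisfiesHeegnerHypothesis (W.conductorNorm ℤ) K → Odd (NumberField.discr K) → NumberField.discr K ≠ -3 → AddSubgroup.torsionBy (W.baseChange K).toAffine.Point (2 : ℤ) = ⊥ → Literature.NumberTheory.EllipticCurves.SatisfiesHeegnerHypothesis 2 K → ∀ (Dt : Literature.NumberTheory.EllipticCurves.ModularForms.ModularParametrizationData W (W.conductorNorm ℤ)) (β : ℤ) (ι : K →+* ℂ) [∀ k : ℕ, NumberField (ringClassField K ι k)], (4 * (W.conductorNorm ℤ : ℤ)) ∣ β ^ 2 - NumberField.discr K →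
    ∀ (τ : K ≃ₐ[ℚ] K), τ ≠ 1 →
      ∃ (m : ℕ) (sg : Fin m → ℤ) (i₀ : Fin m) (J d : ℕ), Odd m ∧ (∀ i, sg i = 1 ∨ sg i = -1) ∧
        ∀ k : ℕ, 1 ≤ k → ∃ g : Fin m → galH1Torsion (W.baseChange K) ((2 ^ k : ℕ) : ℤ),
          (∀ i, g i ∈ Jetchev2008.modifiedSelmerGroup W K ι ((2 ^ k : ℕ) : ℤ) 1) ∧
          (∀ i, conjAct W τ ((2 ^ k : ℕ) : ℤ) (g i) = sg i • g i) ∧ addOrderOf (g i₀) = 2 ^ k ∧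
          (∀ u : galH1Torsion (W.baseChange K) ((2 ^ k : ℕ) : ℤ),
            u ∈ Jetchev2008.modifiedSelmerGroup W K ι ((2 ^ k : ℕ) : ℤ) 1 → ∃ b : Fin m → ℤ,
              ∀ ρ ∈ torsionFixing (W.baseChange K) ((2 ^ (k + 1) : ℕ) : ℤ),
                h1Eval (W.baseChange K) ((2 ^ k : ℕ) : ℤ) (((2 : ℤ) ^ J) • u - ∑ i, b i • g i) ρ = 0) ∧
          (∀ b : Fin m → ℤ, (∀ ρ ∈ torsionFixing (W.baseChange K) ((2 ^ (k + 1) : ℕ) : ℤ),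
              h1Eval (W.baseChange K) ((2 ^ k : ℕ) : ℤ) (∑ i, b i • g i) ρ = 0) → ∀ i, (2 : ℤ) ^ (k - d) ∣ b i)

/-- **N3‴ · SELMER-LEVEL START EIGENFRAME AT 2** (v5; THE registered stub's conclusion — Selmer currency, signs LEVEL-FREE by the
`Fin r₊ ⊕ Fin r₋` ordering, critic #262 PRICE (1)).  On U1's habitat and frame, for the non-trivial `τ ∈ Gal(K/ℚ)`: level-free ranks
`r₊, r₋` with `r₊ + r₋` ODD and a generation exponent `J₀` such that for every `k ≥ 1` the start vertex `Sel_{2^k}(E/K)`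
(`Jetchev2008.modifiedSelmerGroup W K ι 2^k 1`, = the Kummer Selmer group by `Jetchev2008.modifiedSelmerGroup_one`) contains `τ`-FIXED classes
`e : Fin r₊ → H¹(K, E[2^k])` and `τ`-ANTI-FIXED classes `f : Fin r₋ → H¹(K, E[2^k])`, none killed by `2^(k−1)` (so of exact order `2^k`),
JOINTLY FREE WITH LOSS ONE (`∑ aᵢeᵢ + ∑ bⱼfⱼ = 0 ⇒ 2^(k−1) ∣ aᵢ ∧ 2^(k−1) ∣ bⱼ`; loss one is SHARP — in a regular block `ℤ/2^k[C₂]`,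
`2^(k−1)((g+τg) + (g−τg)) = 0`) and GENERATING up to `2^J₀` (`2^J₀ · y ∈ span(e, f)` for every `y ∈ Sel_{2^k}`).
PROOF PLAN (every algebraic step already sorry-free; the residue is the DICTIONARY + P17): with `A := Sel_{2^∞}(E/K)` (`selmerGroupPInfty`),
cofinitely generated (`finite_torsionBy_selmerGroupPInfty`, `exists_pow_nsmul_eq_zero_galH1Primary`), `C := 2^{κ₀} A` its divisible part
(`exists_torsionBy_inf_range_stable` / `exists_nsmul_eq_of_stable`; `#(A/C) ∣ 2^κ₀`), `τ := conjAct` on `H¹(K, E[2^∞])` (`C` is `τ`-stable: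
characteristic): (1) `EigenframeFinite.eigenframe_of_divisible_finite τ C` (HOME `line17/EigenframeFiniteLevel.lean` v2.1, sorry-free) gives
`r₊ r₋` and, for all `k`, frames `e' ⊆ C₊[2^k]`, `f' ⊆ C₋[2^k]` with eigen-signs, `2^k`-torsion, `2^(k−1) • ≠ 0`, joint loss-one and
`2 · C[2^k] ⊆ span`; (2) DICTIONARY (the one piece to type, size M⁻): `T_k : H¹(K, E[2^k]) → H¹(K, E[2^∞])`
(`resH1Hom (ContinuousMonoidHom.id Γ_K) (AddSubgroup.inclusion (E[2^k] ≤ E[2^∞]))`; `torsionToPrimaryH1` is the case `k = 1`) is INJECTIVE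
(`E(K)[2] = 0 ⇒ E(K̄)^{Γ_K}[2^∞] = 0`), has image `H¹(K, E[2^∞])[2^k]` (`exists_nsmul_eq_geomPoints`), is `τ`-equivariant, and
`T_k⁻¹(Sel_{2^∞}) = Sel_{2^k}` (both are preimages of `Ш`: `selmerGroup_eq_comap_sha`, `selmerGroupPInfty_eq_comap_sha`; then
`selmerGroup_eq_selmerGroup_kummerSelmerStructure` + `Jetchev2008.modifiedSelmerGroup_one` to reach `H_{𝓕(1)}`); pull `e', f'` back: `e, f`;
injectivity transports loss-one and `2^(k−1) • ≠ 0`, and for `y ∈ Sel_{2^k}`: `2^κ₀ T_k y ∈ C[2^k]`, so `2^(κ₀+1) y ∈ span` — `J₀ := κ₀ + 1`;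
(3) ODDNESS `r₊ + r₋ = dim_{𝔽₂} C[2]` (`EigenRankIdentity.natCard_torsionBy_two_eq_mul_of_involution`, sorry-free, HOME) `= corank_{ℤ₂} A`
`= rank E(K) + corank Ш[2^∞]` (`selmerCorank_eq_mordellWeilRank_add_of_finite_sha`-shape, tree) and `rank E(K) + dim Ш[2] ≡ r₂(K) = 1` is P17
(frame: `K` imaginary quadratic, Heegner for `2` and `N`), while `dim Ш[2] − corank Ш[2^∞] = dim (Ш[2^∞]/div)[2]` is EVEN (tree THEOREMS
`WeierstrassCurve.exists_casselsTate_pairing_holds` — kernel = `AddSubgroup.divisibleElements` as typed — and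
`even_finrank_modN_primaryComponent_sha`; counting `EigenRankIdentity.natCard_torsionBy_eq_quotient_mul`).  Why it might fail: only mis-typing
of the dictionary (print-level mathematics: Milne ADT I §6, Greenberg 1999 §2); it is the ONE place 2-parity enters LINE 17.  Deciding instrument:
none needed (algebra); the K1 finite-group row of the card decides S2, not N3‴.  [cite: Monsky1996, Lemma 1.4(b)] [cite: Kramer1981, Thm. 1]
[cite: MilneADT2006, I Thm. 6.13, Cor. 6.24] [cite: Greenberg1999, §1–2] [cite: GrossLMS1991, §9 Prop. 9.1] -/
def SelmerEigenframeAtTwo : Prop :=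
  ∀ (W : WeierstrassCurve ℚ) [W.IsElliptic] [W.IsGloballyMinimal], ¬ W.HasCM → (Literature.NumberTheory.EllipticCurves.Rank1Residual.GoodOrd W 2 ∨ Literature.NumberTheory.EllipticCurves.Rank1Residual.Mult W 2) → (∀ m : ℕ, W.HasSurjectiveModNGaloisRep (2 ^ m : ℕ)) → ∀ (K : Type) [Field K] [NumberField K], Literature.NumberTheory.EllipticCurves.IsImaginaryQuadratic K → ∀ [NeZero (W.conductorNorm ℤ)], Literature.NumberTheory.EllipticCurves.SatisfiesHeegnerHypothesis (W.conductorNorm ℤ) K → Odd (NumberField.discr K) → NumberField.discr K ≠ -3 → AddSubgroup.torsionBy (W.baseChange K).toAffine.Point (2 : ℤ) = ⊥ → Literature.NumberTheory.EllipticCurves.SatisfiesHeegnerHypothesis 2 K → ∀ (Dt : Literature.NumberTheory.EllipticCurves.ModularForms.ModularParametrizationData W (W.conductorNorm ℤ)) (β : ℤ) (ι : K →+* ℂ) [∀ k : ℕ, NumberField (ringClassField K ι k)], (4 * (W.conductorNorm ℤ : ℤ)) ∣ β ^ 2 - NumberField.discr K →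
    ∀ (τ : K ≃ₐ[ℚ] K), τ ≠ 1 →
      ∃ rp rm J₀ : ℕ, Odd (rp + rm) ∧ ∀ k : ℕ, 1 ≤ k →
        ∃ (e : Fin rp → galH1Torsion (W.baseChange K) ((2 ^ k : ℕ) : ℤ))
          (f : Fin rm → galH1Torsion (W.baseChange K) ((2 ^ k : ℕ) : ℤ)),
          (∀ i, e i ∈ Jetchev2008.modifiedSelmerGroup W K ι ((2 ^ k : ℕ) : ℤ) 1) ∧
          (∀ j, f j ∈ Jetchev2008.modifiedSelmerGroup W K ι ((2 ^ k : ℕ) : ℤ) 1) ∧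
          (∀ i, conjAct W τ ((2 ^ k : ℕ) : ℤ) (e i) = e i) ∧
          (∀ j, conjAct W τ ((2 ^ k : ℕ) : ℤ) (f j) = -f j) ∧
          (∀ i, (2 : ℤ) ^ (k - 1) • e i ≠ 0) ∧ (∀ j, (2 : ℤ) ^ (k - 1) • f j ≠ 0) ∧
          (∀ (a : Fin rp → ℤ) (b : Fin rm → ℤ), ∑ i, a i • e i + ∑ j, b j • f j = 0 →
            (∀ i, (2 : ℤ) ^ (k - 1) ∣ a i) ∧ (∀ j, (2 : ℤ) ^ (k - 1) ∣ b j)) ∧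
          (∀ y : galH1Torsion (W.baseChange K) ((2 ^ k : ℕ) : ℤ),
            y ∈ Jetchev2008.modifiedSelmerGroup W K ι ((2 ^ k : ℕ) : ℤ) 1 →
            ∃ (a : Fin rp → ℤ) (b : Fin rm → ℤ), ((2 : ℤ) ^ J₀) • y = ∑ i, a i • e i + ∑ j, b j • f j)

/-- Exact order `2^k` in `H¹(K, E[2^k])` from «not killed by `2^(k−1)`» (everything is killed by `2^k`:
`zsmul_galH1Torsion_eq_zero`). [folklore] -/
theorem addOrderOf_eq_two_pow_of_ne {K : Type} [Field K] [NumberField K] (W : WeierstrassCurve ℚ) {k : ℕ}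
    (x : galH1Torsion (W.baseChange K) ((2 ^ k : ℕ) : ℤ)) (hx : (2 : ℤ) ^ (k - 1) • x ≠ 0) :
    addOrderOf x = 2 ^ k := by
  have h0 : (((2 : ℕ) : ℤ) ^ k) • x = 0 := by
    have h := zsmul_galH1Torsion_eq_zero (W.baseChange K) ((2 ^ k : ℕ) : ℤ) x
    simpa only [Nat.cast_pow] using h
  refine KolyvaginDescent.addOrderOf_eq_prime_pow Nat.prime_two h0 ?_
  rw [Nat.cast_ofNat]
  exact hx

/-- **KERNEL BRIDGE N3‴ ⇒ N3 (walk currency)**, sorry-free: append the two eigen-families (`g := Fin.append e f`, level-free pattern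
`sg := (+1,…,+1,−1,…,−1)`, `i₀ := 0`), (F3) with `J := J₀` (the difference is `0`), (F4) with `d := 2` by Sah at `2`
(`RegularWalk.two_zsmul_eq_zero_of_res_eq_zero`, needs `ρ_{E,2^(k+1)}` onto — the habitat) and loss-one freeness.
[cite: GrossLMS1991, §9 Prop. 9.1] -/
theorem startFrameAtTwo_of_selmerEigenframe (h : SelmerEigenframeAtTwo) : StartFrameAtTwo := by
  intro W _ _ hCM hred hsur K _ _ hK _ hH hodd hd3 htors hH2 Dt β ι _ hβ τ hτ
  obtain ⟨rp, rm, J₀, hOdd, hfr⟩ := h W hCM hred hsur K hK hH hodd hd3 htors hH2 Dt β ι hβ τ hτ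
  have hm : 0 < rp + rm := hOdd.pos
  refine ⟨rp + rm, Fin.append (fun _ ↦ (1 : ℤ)) (fun _ ↦ (-1 : ℤ)), ⟨0, hm⟩, J₀, 2, hOdd, ?_, fun k hk ↦ ?_⟩
  · intro i
    induction i using Fin.addCases with
    | left i => left; rw [Fin.append_left]
    | right j => right; rw [Fin.append_right]
  · obtain ⟨e, f, heS, hfS, heτ, hfτ, heo, hfo, hI, hgen⟩ := hfr k hk
    -- sums over the appended frame split into the two eigen-parts
    have hsplit : ∀ b : Fin (rp + rm) → ℤ, ∑ i, b i • Fin.append e f i =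
        ∑ i, b (Fin.castAdd rm i) • e i + ∑ j, b (Fin.natAdd rp j) • f j := fun b ↦ by
      rw [Fin.sum_univ_add]
      simp only [Fin.append_left, Fin.append_right]
    -- loss-one independence of the appended frame
    have hI' : ∀ a : Fin (rp + rm) → ℤ, ∑ i, a i • Fin.append e f i = 0 → ∀ i, (2 : ℤ) ^ (k - 1) ∣ a i := by
      intro a ha i
      rw [hsplit] at ha
      obtain ⟨h1, h2⟩ := hI _ _ ha
      induction i using Fin.addCases with
      | left i => exact h1 i
      | right j => exact h2 j
    refine ⟨Fin.append e f, ?_, ?_, ?_, ?_, ?_⟩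
    · -- membership in the start vertex
      intro i
      induction i using Fin.addCases with
      | left i => rw [Fin.append_left]; exact heS i
      | right j => rw [Fin.append_right]; exact hfS j
    · -- eigen-signs
      intro i
      induction i using Fin.addCases with
      | left i => rw [Fin.append_left, Fin.append_left, heτ, one_zsmul]
      | right j => rw [Fin.append_right, Fin.append_right, hfτ, neg_one_zsmul]
    · -- exact order of `g i₀`
      have hord : ∀ i, addOrderOf (Fin.append e f i) = 2 ^ k := by
        intro i
        induction i using Fin.addCases with
        | left i => rw [Fin.append_left]; exact addOrderOf_eq_two_pow_of_ne W (e i) (heo i)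
        | right j => rw [Fin.append_right]; exact addOrderOf_eq_two_pow_of_ne W (f j) (hfo j)
      exact hord _
    · -- (F3) with `J = J₀`
      intro u hu
      obtain ⟨a, b, hab⟩ := hgen u hu
      refine ⟨Fin.append a b, fun ρ hρ ↦ ?_⟩
      have h0 : ((2 : ℤ) ^ J₀) • u - ∑ i, Fin.append a b i • Fin.append e f i = 0 := by
        rw [hsplit, sub_eq_zero, hab]
        simp only [Fin.append_left, Fin.append_right]
      rw [h0]
      have h := Summit.BirchSwinnertonDyer.BirchSwinnertonDyer.Theorems.KolyvaginAtTwo.RegularWalk.res_sub W k 0 0 hρ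
      rwa [sub_zero, sub_self] at h
    · -- (F4) with `d = 2`
      intro b hb i
      have h2 : (2 : ℤ) • ∑ i, b i • Fin.append e f i = 0 :=
        Summit.BirchSwinnertonDyer.BirchSwinnertonDyer.Theorems.KolyvaginAtTwo.RegularWalk.two_zsmul_eq_zero_of_res_eq_zero
          W hK (hsur (k + 1)) hb
      rw [Summit.BirchSwinnertonDyer.BirchSwinnertonDyer.Theorems.KolyvaginAtTwo.RegularWalk.zsmul_finset_sum] at h2
      simp_rw [Summit.BirchSwinnertonDyer.BirchSwinnertonDyer.Theorems.KolyvaginAtTwo.RegularWalk.zsmul_zsmul_eq_mul_zsmul] at h2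
      have hdiv := hI' (fun i ↦ 2 * b i) h2 i
      by_cases hk2 : 2 ≤ k
      · have e2 : (2 : ℤ) ^ (k - 1) = 2 * 2 ^ (k - 2) := by
          rw [← pow_succ']; congr 1; omega
        rw [e2] at hdiv
        exact (mul_dvd_mul_iff_left two_ne_zero).1 hdiv
      · have e0 : k - 2 = 0 := by omega
        rw [e0, pow_zero]
        exact one_dvd _

/- TOMBSTONE (v5.1): the v5 stub N3‴ `stub_selmerEigenframeAtTwo : TwoSelmerParityOverK → SelmerEigenframeAtTwo` stood here.  DISCHARGED:
krr2-p2 g16 proved the start frame from 2-parity directly in the tree (`RegularWalk.startFrameAtTwo_of_twoSelmerParity`, p704817), through the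
same eigenframe algebra; the line no longer files it.  Do not re-file. -/


/-- Certificate: the N3‴ stub is literally `TwoSelmerParityOverK → SelmerEigenframeAtTwo`. -/
example : (TwoSelmerParityOverK → SelmerEigenframeAtTwo) ↔
    ((∀ (W : WeierstrassCurve ℚ) [W.IsElliptic] (K : Type) [Field K] [NumberField K],
    Module.finrank ℚ K = 2 → Literature.NumberTheory.EllipticCurves.SatisfiesHeegnerHypothesis 2 K →
      Literature.NumberTheory.EllipticCurves.SatisfiesHeegnerHypothesis (W.conductorNorm ℤ) K →
        ∀ u : ℕ, Nat.card (AddSubgroup.torsionBy (W.baseChange K).sha (2 : ℤ)) = 2 ^ u →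
          ((W.baseChange K).mordellWeilRank + u) % 2 = NumberField.InfinitePlace.nrComplexPlaces K % 2) →
  ∀ (W : WeierstrassCurve ℚ) [W.IsElliptic] [W.IsGloballyMinimal], ¬ W.HasCM → (Literature.NumberTheory.EllipticCurves.Rank1Residual.GoodOrd W 2 ∨ Literature.NumberTheory.EllipticCurves.Rank1Residual.Mult W 2) → (∀ m : ℕ, W.HasSurjectiveModNGaloisRep (2 ^ m : ℕ)) → ∀ (K : Type) [Field K] [NumberField K], Literature.NumberTheory.EllipticCurves.IsImaginaryQuadratic K → ∀ [NeZero (W.conductorNorm ℤ)], Literature.NumberTheory.EllipticCurves.SatisfiesHeegnerHypothesis (W.conductorNorm ℤ) K → Odd (NumberField.discr K) → NumberField.discr K ≠ -3 → AddSubgroup.torsionBy (W.baseChange K).toAffine.Point (2 : ℤ) = ⊥ → Literature.NumberTheory.EllipticCurves.SatisfiesHeegnerHypothesis 2 K → ∀ (Dt : Literature.NumberTheory.EllipticCurves.ModularForms.ModularParametrizationData W (W.conductorNorm ℤ)) (β : ℤ) (ι : K →+* ℂ) [∀ k : ℕ, NumberField (ringClassField K ι k)], (4 * (W.conductorNorm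 ℤ : ℤ)) ∣ β ^ 2 - NumberField.discr K →
    ∀ (τ : K ≃ₐ[ℚ] K), τ ≠ 1 →
      ∃ rp rm J₀ : ℕ, Odd (rp + rm) ∧ ∀ k : ℕ, 1 ≤ k →
        ∃ (e : Fin rp → galH1Torsion (W.baseChange K) ((2 ^ k : ℕ) : ℤ))
          (f : Fin rm → galH1Torsion (W.baseChange K) ((2 ^ k : ℕ) : ℤ)),
          (∀ i, e i ∈ Jetchev2008.modifiedSelmerGroup W K ι ((2 ^ k : ℕ) : ℤ) 1) ∧
          (∀ j, f j ∈ Jetchev2008.modifiedSelmerGroup W K ι ((2 ^ k : ℕ) : ℤ) 1) ∧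
          (∀ i, conjAct W τ ((2 ^ k : ℕ) : ℤ) (e i) = e i) ∧
          (∀ j, conjAct W τ ((2 ^ k : ℕ) : ℤ) (f j) = -f j) ∧
          (∀ i, (2 : ℤ) ^ (k - 1) • e i ≠ 0) ∧ (∀ j, (2 : ℤ) ^ (k - 1) • f j ≠ 0) ∧
          (∀ (a : Fin rp → ℤ) (b : Fin rm → ℤ), ∑ i, a i • e i + ∑ j, b j • f j = 0 →
            (∀ i, (2 : ℤ) ^ (k - 1) ∣ a i) ∧ (∀ j, (2 : ℤ) ^ (k - 1) ∣ b j)) ∧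
          (∀ y : galH1Torsion (W.baseChange K) ((2 ^ k : ℕ) : ℤ),
            y ∈ Jetchev2008.modifiedSelmerGroup W K ι ((2 ^ k : ℕ) : ℤ) 1 →
            ∃ (a : Fin rp → ℤ) (b : Fin rm → ℤ), ((2 : ℤ) ^ J₀) • y = ∑ i, a i • e i + ∑ j, b j • f j)) := Iff.rfl

/-- **S1b ⇐ N3‴ + P17** (v5 composition; kernel-checked, no sorry of its own): the Selmer eigenframe, bridged to the walk's start frame,
fed to krr2-p2's landed walk `RegularWalk.nearCoreExistenceAtTwo_of_startFrame` (N4, BY NAME). -/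
theorem nearCoreExistenceAtTwo_of_eigenframe (h3 : TwoSelmerParityOverK → SelmerEigenframeAtTwo) (hP : TwoSelmerParityOverK) :
    NearCoreExistenceAtTwo :=
  Summit.BirchSwinnertonDyer.BirchSwinnertonDyer.Theorems.KolyvaginAtTwo.RegularWalk.nearCoreExistenceAtTwo_of_startFrame
    (startFrameAtTwo_of_selmerEigenframe (h3 hP))

/-- **S1b ⇐ N3 (walk currency) + P17** — the second road (no sorry): a DIRECT landing of `TwoSelmerParityOverK → StartFrameAtTwo`
(reader g15's start-frame text) closes S1b through the same kernel theorem. -/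
theorem nearCoreExistenceAtTwo_of_startFrame' (h3 : TwoSelmerParityOverK → StartFrameAtTwo) (hP : TwoSelmerParityOverK) :
    NearCoreExistenceAtTwo :=
  Summit.BirchSwinnertonDyer.BirchSwinnertonDyer.Theorems.KolyvaginAtTwo.RegularWalk.nearCoreExistenceAtTwo_of_startFrame (h3 hP)

/-- Certificate: the walk-currency road's input as ONE statement, for a direct landing (reader g15's `stub_startFrameAtTwo` with the
parity antecedent visible). -/
example : (TwoSelmerParityOverK → StartFrameAtTwo) ↔
    ((∀ (W : WeierstrassCurve ℚ) [W.IsElliptic] (K : Type) [Field K] [NumberField K],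
    Module.finrank ℚ K = 2 → Literature.NumberTheory.EllipticCurves.SatisfiesHeegnerHypothesis 2 K →
      Literature.NumberTheory.EllipticCurves.SatisfiesHeegnerHypothesis (W.conductorNorm ℤ) K →
        ∀ u : ℕ, Nat.card (AddSubgroup.torsionBy (W.baseChange K).sha (2 : ℤ)) = 2 ^ u →
          ((W.baseChange K).mordellWeilRank + u) % 2 = NumberField.InfinitePlace.nrComplexPlaces K % 2) →
  ∀ (W : WeierstrassCurve ℚ) [W.IsElliptic] [W.IsGloballyMinimal], ¬ W.HasCM → (Literature.NumberTheory.EllipticCurves.Rank1Residual.GoodOrd W 2 ∨ Literature.NumberTheory.EllipticCurves.Rank1Residual.Mult W 2) → (∀ m : ℕ, W.HasSurjectiveModNGaloisRep (2 ^ m : ℕ)) → ∀ (K : Type) [Field K] [NumberField K], Literature.NumberTheory.EllipticCurves.IsImaginaryQuadratic K → ∀ [NeZero (W.conductorNorm ℤ)], Literature.NumberTheory.EllipticCurves.SatisfiesHeegnerHypothesis (W.conductorNorm ℤ) K → Odd (NumberField.discr K) → NumberField.discr K ≠ -3 → AddSubgroup.torsionBy (W.baseChange K).toAffine.Point (2 :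 ℤ) = ⊥ → Literature.NumberTheory.EllipticCurves.SatisfiesHeegnerHypothesis 2 K → ∀ (Dt : Literature.NumberTheory.EllipticCurves.ModularForms.ModularParametrizationData W (W.conductorNorm ℤ)) (β : ℤ) (ι : K →+* ℂ) [∀ k : ℕ, NumberField (ringClassField K ι k)], (4 * (W.conductorNorm ℤ : ℤ)) ∣ β ^ 2 - NumberField.discr K →
    ∀ (τ : K ≃ₐ[ℚ] K), τ ≠ 1 →
      ∃ (m : ℕ) (sg : Fin m → ℤ) (i₀ : Fin m) (J d : ℕ), Odd m ∧ (∀ i, sg i = 1 ∨ sg i = -1) ∧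
        ∀ k : ℕ, 1 ≤ k → ∃ g : Fin m → galH1Torsion (W.baseChange K) ((2 ^ k : ℕ) : ℤ),
          (∀ i, g i ∈ Jetchev2008.modifiedSelmerGroup W K ι ((2 ^ k : ℕ) : ℤ) 1) ∧
          (∀ i, conjAct W τ ((2 ^ k : ℕ) : ℤ) (g i) = sg i • g i) ∧ addOrderOf (g i₀) = 2 ^ k ∧
          (∀ u : galH1Torsion (W.baseChange K) ((2 ^ k : ℕ) : ℤ),
            u ∈ Jetchev2008.modifiedSelmerGroup W K ι ((2 ^ k : ℕ) : ℤ) 1 → ∃ b : Fin m → ℤ,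
              ∀ ρ ∈ torsionFixing (W.baseChange K) ((2 ^ (k + 1) : ℕ) : ℤ),
                h1Eval (W.baseChange K) ((2 ^ k : ℕ) : ℤ) (((2 : ℤ) ^ J) • u - ∑ i, b i • g i) ρ = 0) ∧
          (∀ b : Fin m → ℤ, (∀ ρ ∈ torsionFixing (W.baseChange K) ((2 ^ (k + 1) : ℕ) : ℤ),
              h1Eval (W.baseChange K) ((2 ^ k : ℕ) : ℤ) (∑ i, b i • g i) ρ = 0) → ∀ i, (2 : ℤ) ^ (k - d) ∣ b i)) := Iff.rfl

/-- P17 stub (v5.1: the Literature constant BY NAME — a PRINT input, never progress): 2-parity of the 2-Selmer rank over quadratic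
fields, Kramer–Monsky form. [cite: Monsky1996, Lemma 1.4(b)] [cite: Kramer1981, Thm. 1] -/
theorem stub_twoSelmerParityOverK :
    Literature.NumberTheory.EllipticCurves.Monsky1996_lemma14b_twoSelmerRank_parity :=
  -- v5.2 (krr2-p2 g17): P17 is a TREE THEOREM — gk2-p5 g19's `GenusKolyArch.Monsky1996_lemma14b_twoSelmerRank_parity_holds`
  -- (Theorems/GenusKolyvaginAtTwoGenusPrimitiveSupplyAtTwoMonskyLemma14b.lean; Cassels–Tate over K and ℚ, DD10 Lemma 4.14, Kramer's congruence).
  Summit.BirchSwinnertonDyer.BirchSwinnertonDyer.Theorems.GenusKolyArch.Monsky1996_lemma14b_twoSelmerRank_parity_holds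

example : TwoSelmerParityOverK ↔
    (∀ (W : WeierstrassCurve ℚ) [W.IsElliptic] (K : Type) [Field K] [NumberField K],
        Module.finrank ℚ K = 2 → Literature.NumberTheory.EllipticCurves.SatisfiesHeegnerHypothesis 2 K →
          Literature.NumberTheory.EllipticCurves.SatisfiesHeegnerHypothesis (W.conductorNorm ℤ) K →
            ∀ u : ℕ, Nat.card (AddSubgroup.torsionBy (W.baseChange K).sha (2 : ℤ)) = 2 ^ u →
              ((W.baseChange K).mordellWeilRank + u) % 2 = NumberField.InfinitePlace.nrComplexPlaces K % 2) := Iff.rfl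


/-- Certificate (v5.1): the pen's `TwoSelmerParityOverK` IS the Literature constant (definitional). -/
example : TwoSelmerParityOverK ↔ Literature.NumberTheory.EllipticCurves.Monsky1996_lemma14b_twoSelmerRank_parity := Iff.rfl

/-- **S1b ⇐ krr2-p2's START FRAME FROM PARITY (v5.1, BY NAME) + P17**: kernel `nearCoreExistenceAtTwo_of_startFrame` ∘
`startFrameAtTwo_of_twoSelmerParity`; no sorry of its own. -/
theorem nearCoreExistenceAtTwo_of_parity
    (hP : Literature.NumberTheory.EllipticCurves.Monsky1996_lemma14b_twoSelmerRank_parity) : NearCoreExistenceAtTwo :=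
  Summit.BirchSwinnertonDyer.BirchSwinnertonDyer.Theorems.KolyvaginAtTwo.RegularWalk.nearCoreExistenceAtTwo_of_startFrame
    (Summit.BirchSwinnertonDyer.BirchSwinnertonDyer.Theorems.KolyvaginAtTwo.RegularWalk.startFrameAtTwo_of_twoSelmerParity hP)

/-- S1 (derived since v3; v5.1: S1 ⇐ S1b ⇐ N4-kernel ∘ krr2-p2's start frame ∘ P17, all BY NAME). -/
theorem regularCoreSupplyAtTwo_of_stub : RegularCoreSupplyAtTwo :=
  regularCoreSupplyAtTwo_of_nearCore (nearCoreExistenceAtTwo_of_parity stub_twoSelmerParityOverK)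

/-- S2 (hardest): core rigidity at 2 — one global defect at all regular core vertices (MR Cor. 2.8.9 (2),
Thm. 3.2.3, Howard Thm. 2.8.8 at p = 2 with (H.2) := regularity). -/
theorem stub_coreRigidityAtTwo :
  ∀ (W : WeierstrassCurve ℚ) [W.IsElliptic] [W.IsGloballyMinimal], ¬ W.HasCM → (Literature.NumberTheory.EllipticCurves.Rank1Residual.GoodOrd W 2 ∨ Literature.NumberTheory.EllipticCurves.Rank1Residual.Mult W 2) → (∀ m : ℕ, W.HasSurjectiveModNGaloisRep (2 ^ m : ℕ)) → ∀ (K : Type) [Field K] [NumberField K], Literature.NumberTheory.EllipticCurves.IsImaginaryQuadratic K → ∀ [NeZero (W.conductorNorm ℤ)], Literature.NumberTheory.EllipticCurves.SatisfiesHeegnerHypothesis (W.conductorNorm ℤ) K → Odd (NumberField.discr K) → NumberField.discr K ≠ -3 → AddSubgroup.torsionBy (W.baseChange K).toAffine.Point (2 : ℤ) = ⊥ → Literature.NumberTheory.EllipticCurves.SatisfiesHeegnerHypothesis 2 K → ∀ (Dt : Literature.NumberTheory.EllipticCurves.ModularForms.ModularParametrizationData W (W.conductorNorm ℤ)) (β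 : ℤ) (ι : K →+* ℂ) [∀ k : ℕ, NumberField (ringClassField K ι k)], (4 * (W.conductorNorm ℤ : ℤ)) ∣ β ^ 2 - NumberField.discr K → ∀ κ : ℕ,
    (∃ (n₁ : ℕ) (d₁ : Literature.NumberTheory.EllipticCurves.KolyvaginHeegnerData Dt β ι n₁) (M₁ : ℕ),
        Literature.NumberTheory.EllipticCurves.KolyvaginDescent.KolSupp (Literature.NumberTheory.EllipticCurves.Zhang2014.IsKolyvaginPrime (W.conductorNorm ℤ) W K 2) n₁ ∧
        1 ≤ M₁ ∧ (M₁ : ℕ∞) ≤ Literature.NumberTheory.EllipticCurves.Zhang2014.levelIndex W 2 n₁ ∧ d₁.kolyvaginClass Nat.prime_two M₁ ≠ 0) →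
    ∃ a : ℕ, ∀ (M n : ℕ) (d : Literature.NumberTheory.EllipticCurves.KolyvaginHeegnerData Dt β ι n),
      Literature.NumberTheory.EllipticCurves.KolyvaginDescent.KolSupp (Literature.NumberTheory.EllipticCurves.Zhang2014.IsKolyvaginPrime (W.conductorNorm ℤ) W K 2) n →
      (∀ ℓ ∈ n.primeFactors, M ≤ Literature.NumberTheory.EllipticCurves.Zhang2014.kolyvaginIndex W 2 ℓ ∧ (∃ (v : HeightOneSpectrum (𝓞 ℚ)) (𝔓 : Ideal (absIntegers (𝓞 ℚ) ℚ)) (h : absoluteGaloisGroup ℚ), (ℓ : 𝓞 ℚ) ∈ v.asIdeal ∧ 𝔓 ∈ v.primesAbove ∧ IsArithFrobAt (𝓞 ℚ) h 𝔓 ∧ (∀ X : geomTorsion W ((2 ^ M : ℕ) : ℤ), h • h • X = X) ∧ ∃ P : geomTorsion W ((2 ^ M : ℕ) : ℤ), (2 : ℤ) ^ (M - 1) • (P + h • P) ≠ 0)) →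
      (∃ x ∈ Jetchev2008.modifiedSelmerGroup W K ι ((2 ^ M : ℕ) : ℤ) n, addOrderOf x = 2 ^ M ∧ ∀ y ∈ Jetchev2008.modifiedSelmerGroup W K ι ((2 ^ M : ℕ) : ℤ) n, ∃ t : ℤ, (2 ^ κ : ℤ) • y = t • x) → a < M →
      (2 ^ (M - a - 1) : ℤ) • d.kolyvaginClass Nat.prime_two M ≠ 0 := by
  sorry

/-- Certificate: the expanded S2 signature (v3.2: expansion only — so that a `Theorems/` landing can state the stub verbatim without
importing this sorried file; content byte-identical to v3's `CoreRigidityAtTwo`) is `CoreRigidityAtTwo` on the nose. -/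
example : CoreRigidityAtTwo ↔
    (∀ (W : WeierstrassCurve ℚ) [W.IsElliptic] [W.IsGloballyMinimal], ¬ W.HasCM → (Literature.NumberTheory.EllipticCurves.Rank1Residual.GoodOrd W 2 ∨ Literature.NumberTheory.EllipticCurves.Rank1Residual.Mult W 2) → (∀ m : ℕ, W.HasSurjectiveModNGaloisRep (2 ^ m : ℕ)) → ∀ (K : Type) [Field K] [NumberField K], Literature.NumberTheory.EllipticCurves.IsImaginaryQuadratic K → ∀ [NeZero (W.conductorNorm ℤ)], Literature.NumberTheory.EllipticCurves.SatisfiesHeegnerHypothesis (W.conductorNorm ℤ) K → Odd (NumberField.discr K) → NumberField.discr K ≠ -3 → AddSubgroup.torsionBy (W.baseChange K).toAffine.Point (2 : ℤ) = ⊥ → Literature.NumberTheory.EllipticCurves.SatisfiesHeegnerHypothesis 2 K → ∀ (Dt : Literature.NumberTheory.EllipticCurves.ModularForms.ModularParametrizationData W (W.conductorNorm ℤ)) (β : ℤ) (ι : K →+* ℂ) [∀ k : ℕ, NumberField (ringClassField K ι k)], (4 * (W.conductorNorm ℤ : ℤ)) ∣ β ^ 2 - NumberField.discr K → ∀ κ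 : ℕ,
        (∃ (n₁ : ℕ) (d₁ : Literature.NumberTheory.EllipticCurves.KolyvaginHeegnerData Dt β ι n₁) (M₁ : ℕ),
            Literature.NumberTheory.EllipticCurves.KolyvaginDescent.KolSupp (Literature.NumberTheory.EllipticCurves.Zhang2014.IsKolyvaginPrime (W.conductorNorm ℤ) W K 2) n₁ ∧
            1 ≤ M₁ ∧ (M₁ : ℕ∞) ≤ Literature.NumberTheory.EllipticCurves.Zhang2014.levelIndex W 2 n₁ ∧ d₁.kolyvaginClass Nat.prime_two M₁ ≠ 0) →
        ∃ a : ℕ, ∀ (M n : ℕ) (d : Literature.NumberTheory.EllipticCurves.KolyvaginHeegnerData Dt β ι n),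
          Literature.NumberTheory.EllipticCurves.KolyvaginDescent.KolSupp (Literature.NumberTheory.EllipticCurves.Zhang2014.IsKolyvaginPrime (W.conductorNorm ℤ) W K 2) n →
          (∀ ℓ ∈ n.primeFactors, M ≤ Literature.NumberTheory.EllipticCurves.Zhang2014.kolyvaginIndex W 2 ℓ ∧ (∃ (v : HeightOneSpectrum (𝓞 ℚ)) (𝔓 : Ideal (absIntegers (𝓞 ℚ) ℚ)) (h : absoluteGaloisGroup ℚ), (ℓ : 𝓞 ℚ) ∈ v.asIdeal ∧ 𝔓 ∈ v.primesAbove ∧ IsArithFrobAt (𝓞 ℚ) h 𝔓 ∧ (∀ X : geomTorsion W ((2 ^ M : ℕ) : ℤ), h • h • X = X) ∧ ∃ P : geomTorsion W ((2 ^ M : ℕ) : ℤ), (2 : ℤ) ^ (M - 1) • (P + h • P) ≠ 0)) →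
          (∃ x ∈ Jetchev2008.modifiedSelmerGroup W K ι ((2 ^ M : ℕ) : ℤ) n, addOrderOf x = 2 ^ M ∧ ∀ y ∈ Jetchev2008.modifiedSelmerGroup W K ι ((2 ^ M : ℕ) : ℤ) n, ∃ t : ℤ, (2 ^ κ : ℤ) • y = t • x) → a < M →
          (2 ^ (M - a - 1) : ℤ) • d.kolyvaginClass Nat.prime_two M ≠ 0) := Iff.rfl

/-- COMPOSITION (kernel-checked, no sorry of its own): S0 → S1 → S2 → U1, with `r` := the depth of S1 and
`m := a` the global defect of S2; the level clause `M ≤ M(n)` from the indices of the regular primes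
(`Zhang2014.natCast_le_levelIndex_iff`), the ring-class-field instance from `JET.numberField_ringClassField`. -/
theorem KolyvaginBoundedDefectAtTwo_of (h0 : KolyvaginNonvanishingAtTwoFrame)
    (h1 : RegularCoreSupplyAtTwo) (h2 : CoreRigidityAtTwo) : KolyvaginBoundedDefectAtTwo := by
  intro W _ _ hCM hred hsurj K _ _ hK _ hH hodd hd3 htors hH2 Dt β ι hβ
  haveI : ∀ k : ℕ, NumberField (ringClassField K ι k) :=
    Summit.BirchSwinnertonDyer.Rank1Residual.JET.numberField_ringClassField K hK ι
  have hseed := h0 W hCM hred hsurj K hK hH hodd hd3 htors hH2 Dt β ι hβ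
  obtain ⟨r, κ, hr⟩ := h1 W hCM hred hsurj K hK hH hodd hd3 htors hH2 Dt β ι hβ
  obtain ⟨a, ha⟩ := h2 W hCM hred hsurj K hK hH hodd hd3 htors hH2 Dt β ι hβ κ hseed
  refine ⟨r, a, fun M hM ↦ ?_⟩
  obtain ⟨n, ⟨d⟩, hKol, hcard, hreg, hcore⟩ := hr M 0 (by omega)
  refine ⟨n, d, hKol, hcard, ?_, ha M n d hKol (fun ℓ hℓ ↦ ⟨(hreg ℓ hℓ).2.1, (hreg ℓ hℓ).2.2⟩) hcore hM⟩
  exact Zhang2014.natCast_le_levelIndex_iff.mpr fun ℓ hℓ ↦ (hreg ℓ hℓ).2.1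

/-- The composition concludes the crux BY NAME (audit anchor). -/
theorem KolyvaginBoundedDefectAtTwo_of_stubs : KolyvaginBoundedDefectAtTwo :=
  KolyvaginBoundedDefectAtTwo_of stub_seedNonvanishingAtTwo regularCoreSupplyAtTwo_of_stub stub_coreRigidityAtTwo

end Summit.BirchSwinnertonDyer.BirchSwinnertonDyer.Cruxes.KolyvaginBoundedDefectAtTwo.RegularCoreRigidity

end
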